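import Mathlib
import Literature.Analysis.Convolution.LaplaceTransformConvolution
import HarnessLib

/-!
# Crux `UnitSpeedTwoPoint` — stub A `stub_laplaceMeasurePowerLaw` (line `yukawa_subordination`)

Crux stmt-CriticalPhenomena-17167 (`Theses.UnitLightCone.UnitSpeedTwoPoint`), line
`yukawa_subordination`, registered stub A: **the Bernstein measure of `r^{1-2Δ}`**.  For
`Δ ≥ 1/2` there is an s-finite positive measure `ν` on `ℝ` carried by `[0, ∞)` such that
`m ↦ e^{-mr}` is `ν`-integrable and `∫ e^{-mr} dν(m) = r^{1-2Δ}` for every `r > 0`.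

RUNNING LOG (worker): everything below is proved; nothing is left open.

Proof.  Case `Δ = 1/2`: `ν = δ₀` (`Measure.dirac 0`), `∫ e^{-mr} dδ₀ = 1 = r⁰`.
Case `Δ > 1/2`: with `s := 2Δ - 1 > 0`, `ν = Γ(s)⁻¹ m^{s-1} 1_{m>0} dm`
(`(volume.restrict (Ioi 0)).withDensity`), and `∫₀^∞ e^{-mr} m^{s-1}/Γ(s) dm = r^{-s}` is the
tree's `Literature.Analysis.Convolution.rpow_neg_eq_integral_exp_neg_mul` (Mathlib's Gamma
integral `Real.integral_rpow_mul_exp_neg_mul_Ioi` divided by `Γ(s) > 0`), with integrability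
`Literature.Analysis.Convolution.integrableOn_exp_neg_mul_mul_rpow_div_Gamma`; the `withDensity`
bookkeeping is `integrable_withDensity_iff_integrable_smul'` /
`integral_withDensity_eq_integral_toReal_smul`.

References: D. V. Widder, *The Laplace Transform* (1941), Ch. IV; C. Berg, J. P. R. Christensen,
P. Ressel, *Harmonic Analysis on Semigroups* (1984), §4 (complete monotonicity of `r^{-s}`).
All steps are standard analysis [folklore].
-/

noncomputable section

open MeasureTheory Set

namespace Summit.CriticalPhenomena.Ising3DConformalLimit.Cruxes.UnitSpeedTwoPoint.YukawaSubordination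

/-- Case `Δ = 1/2` of stub A: the Dirac mass at `0` has Laplace transform
`1 = r ^ (1 - 2·(1/2))`. [folklore] -/
theorem laplaceMeasurePowerLaw_dirac :
    ∃ ν : Measure ℝ, SFinite ν ∧ ν (Iio 0) = 0 ∧
      ∀ r : ℝ, 0 < r →
        Integrable (fun m : ℝ => Real.exp (-(m * r))) ν ∧
          ∫ m, Real.exp (-(m * r)) ∂ν = r ^ (1 - 2 * (1 / 2 : ℝ)) := by
  refine ⟨Measure.dirac 0, inferInstance, ?_,
    fun r _ => ⟨integrable_dirac (by simp), ?_⟩⟩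
  · have h0 : (0 : ℝ) ∉ Iio 0 := by simp
    rw [Measure.dirac_apply, Set.indicator_of_notMem h0]
  · rw [integral_dirac]
    norm_num

/-- Case `1/2 < Δ` of stub A: the Gamma density `Γ(2Δ-1)⁻¹ m^{2Δ-2}` on `(0, ∞)` has Laplace
transform `r^{1-2Δ}` (`∫₀^∞ m^{s-1} e^{-rm} dm = r^{-s} Γ(s)`, `s = 2Δ - 1 > 0`). [folklore] -/
theorem laplaceMeasurePowerLaw_density {Δ : ℝ} (hΔ : 1 / 2 < Δ) :
    ∃ ν : Measure ℝ, SFinite ν ∧ ν (Iio 0) = 0 ∧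
      ∀ r : ℝ, 0 < r →
        Integrable (fun m : ℝ => Real.exp (-(m * r))) ν ∧
          ∫ m, Real.exp (-(m * r)) ∂ν = r ^ (1 - 2 * Δ) := by
  have hs : 0 < 2 * Δ - 1 := by linarith
  set g : ℝ → ℝ := fun m => m ^ (2 * Δ - 1 - 1) / Real.Gamma (2 * Δ - 1) with hg
  have hgm : Measurable g := (measurable_id.pow_const _).div_const _
  have hgm' : Measurable fun m => ENNReal.ofReal (g m) := hgm.ennreal_ofReal
  have hgnn : ∀ m : ℝ, 0 < m → 0 ≤ g m := fun m hm =>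
    div_nonneg (Real.rpow_nonneg hm.le _) (Real.Gamma_pos_of_pos hs).le
  have hglt : ∀ᵐ m ∂(volume.restrict (Ioi (0 : ℝ))), ENNReal.ofReal (g m) < ⊤ :=
    ae_of_all _ fun _ => ENNReal.ofReal_lt_top
  refine ⟨(volume.restrict (Ioi 0)).withDensity fun m => ENNReal.ofReal (g m), inferInstance,
    ?_, fun r hr => ⟨?_, ?_⟩⟩
  · -- carried by `[0, ∞)`
    refine withDensity_absolutelyContinuous _ _ ?_
    rw [Measure.restrict_apply measurableSet_Iio]
    have h0 : Iio (0 : ℝ) ∩ Ioi 0 = ∅ :=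
      eq_empty_of_forall_notMem fun x hx => lt_irrefl (0 : ℝ) (hx.2.trans hx.1)
    rw [h0, measure_empty]
  · -- integrability of `e^{-mr}` against the Gamma density
    rw [integrable_withDensity_iff_integrable_smul' hgm' hglt]
    have hint :=
      Literature.Analysis.Convolution.integrableOn_exp_neg_mul_mul_rpow_div_Gamma hs hr
    refine (hint.congr_fun (fun m hm => ?_) measurableSet_Ioi).integrable
    rw [ENNReal.toReal_ofReal (hgnn m hm), smul_eq_mul, mul_comm]
  · -- the Laplace transform
    rw [integral_withDensity_eq_integral_toReal_smul hgm' hglt,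
      show (1 - 2 * Δ) = -(2 * Δ - 1) by ring,
      Literature.Analysis.Convolution.rpow_neg_eq_integral_exp_neg_mul hs hr]
    refine setIntegral_congr_fun measurableSet_Ioi fun m hm => ?_
    rw [ENNReal.toReal_ofReal (hgnn m hm), smul_eq_mul, mul_comm]

/-- Registered stub A `stub_laplaceMeasurePowerLaw` — **Bernstein measure of `r^{1-2Δ}`**: for
`Δ ≥ 1/2` there is an s-finite positive measure `ν` on `ℝ` carried by `[0, ∞)` such that
`m ↦ e^{-mr}` is `ν`-integrable and `∫ e^{-mr} dν(m) = r^{1-2Δ}` for every `r > 0`.  Witness: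
`Δ = 1/2`: `ν = δ₀` (`laplaceMeasurePowerLaw_dirac`); `Δ > 1/2`:
`dν = Γ(2Δ-1)⁻¹ m^{2Δ-2} 1_{m>0} dm` (`laplaceMeasurePowerLaw_density`). [folklore] -/
theorem stub_laplaceMeasurePowerLaw :
    ∀ Δ : ℝ, 1 / 2 ≤ Δ →
      ∃ ν : MeasureTheory.Measure ℝ, MeasureTheory.SFinite ν ∧ ν (Set.Iio 0) = 0 ∧
        ∀ r : ℝ, 0 < r →
          MeasureTheory.Integrable (fun m : ℝ => Real.exp (-(m * r))) ν ∧
            ∫ m, Real.exp (-(m * r)) ∂ν = r ^ (1 - 2 * Δ) := by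
  intro Δ hΔ
  rcases eq_or_lt_of_le hΔ with h | h
  · subst h
    exact laplaceMeasurePowerLaw_dirac
  · exact laplaceMeasurePowerLaw_density h

end Summit.CriticalPhenomena.Ising3DConformalLimit.Cruxes.UnitSpeedTwoPoint.YukawaSubordination

end
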